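import Summits.Ventures.CertifiedManyBodySolver.Observables.TorusWindowTightness

/-!
# The pair-LRO ceiling of translation-invariant sourced ground states is UNIFORM in the state;
# full-sequence forms of window tightness on the torus

Cell `hubbard-cq` (venture `CertifiedManyBodySolver`; seat hubbard-cq-p6, row p4–p6 «finite-`h` Koma–Tasaki dictionary»;
polish of census (44)/(47)). hubbard-cq-p3's ceiling `tiGroundStatePairLROCeiling_holds` («∀ TI ground state `ω` of `Ψ_h`,
∀ ε, eventually in `N`, `boxLRO_N(ω) ≤ (∂⁺E(h)/2)² + ε`») is stated PER ground state, but its proof constants — the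
approximating-Hamiltonian sandwich `ahmTT'_sandwich` (threshold `L₀(g, ε)`), Griffiths (`m_L → m⁺`, `E_L/L² → E`) and
hubbard-cq-p4's box→torus trial-state bound (`c₁ = 4C_src`, `c₂ = 16K_d²`, `L₁ = max 3 L_inj`, `boxTorusBound`) — do
not depend on `ω`. §1 records the UNIFORM form; §2 uses it to remove the «torus-convergent subsequence» qualifier from
the window-tightness theorems of `TorusWindowTightness.lean`:

* §1 `boxTorusBound_uniform` (p4's (ε) with `ω`-independent constants, verbatim re-quantification of p3's `boxTorusBound`)
  and **`tiGroundStatePairLROCeiling_uniform`**: `∀ h₀ ≥ 0, ∀ ε > 0, ∃ N₀, ∀` TI ground states `ω` of `Ψ_{h₀}`,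
  `∀ N ≥ N₀, boxLRO_N(ω) ≤ (∂⁺E(h₀)/2)² + ε` (p3's (ζ)(η) assembly re-run with the quantifiers swapped; adapted from
  `tiGroundStatePairLROCeiling_of_boxTorusBound`).
* §2 `eventually_windowTail_le_of_forall_torusLimit` — ABSTRACT FULL-SEQUENCE PASSAGE (any form factor `g`): if
  `s_{L_j} → c` along the WHOLE sequence and, at ONE box size `n`, every torus limit `ω` of every subsequence has
  `boxavg_n(ω) ≤ c + τ/16`, then for every `ε ≤ π/(6n)`, eventually `T_ε(ψ_{L_j})/L_j² ≤ τ` (contradiction through a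
  torus-convergent sub-subsequence, `exists_isTorusLimitOf_subseq`, and the reverse Fejér inequality). Instances for
  unit ground-state vectors of `dWaveSourceTorusTT' L t' U μ h` along ANY `L_j → ∞`, no torus-limit hypothesis:
  **`eventually_windowTail_le_of_groundStates_of_hasDerivAt'`** (`h > 0` off the kinks: EVERY ground-state sequence
  is window tight), **`eventually_windowTail_le_of_groundStates_zero_of_not_hasDWaveOrderTT''`** (`h = 0`, `m⋆ = 0`),
  `eventually_windowTail_le_of_groundStates_zero_of_tendsto_sq'` (`h = 0`, `s_{L_j} → (m⋆)²` ⇒ tight), and the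
  full-sequence equivalence under `[U]` **`windowTight_iff_tendsto_sq_of_unique_symmetric'`** (fixed-`N` sequences; `⇒`
  via p4's `exists_subseq_tendsto_torusDiagonal_sq_dWaveOrderParameterTT'_of_unique_symmetric_of_tight` on every
  subsequence + `tendsto_of_subseq_tendsto`).

CENSUS SENTENCE (now without qualifiers): at `h > 0` off kinks and at `h = 0` with `m⋆ = 0`, EVERY sequence of ground-state
vectors of the (sourced) grand-canonical `t–t'` tori is window tight; under `[U]` at `h = 0`, window tightness of a
fixed-`N` ground-state sequence ⇔ its torus pair LRO → `(m⋆)²`. HONEST SCOPE / WHAT THIS IS NOT: nothing here bears on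
whether `[BN7]` holds at `h = 0` with `m⋆ > 0`; T5-class dictionary theorems; no number, no instrument, no phase
sentence; not a superconductivity verdict. Everything PROVED; no definition, no named fact; zero compute.

References: T. Koma, H. Tasaki, Commun. Math. Phys. 158 (1993) 191, Thm 7.3 [cite: KomaTasaki1993, Theorem 7.3];
N. N. Bogolyubov Jr., Physica 32 (1966) 933, Thm 1 / J.-B. Bru, W. de Siqueira Pedra, Mem. AMS 224 (2013) Thm 107
[cite: BruPedra2013, Thm 107]; R. B. Griffiths, Phys. Rev. 152 (1966) 240, §II [cite: Griffiths1966, §II];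
T. Kennedy, E. H. Lieb, B. S. Shastry, Phys. Rev. Lett. 61 (1988) 2582 [cite: KLS1988PRL, p. 2583].
-/

noncomputable section

namespace Summit.Ventures.CertifiedManyBodySolver.Observables.TorusWindowTightness

open Matrix Finset Filter Topology Set Literature.MathematicalPhysics.QuantumLattice
open Literature.Probability.LatticeModels HubbardWave0 ThermodynamicLimit
open Summit.Ventures.CertifiedManyBodySolver.Observables.SourcedTorusAHM
open Summit.Ventures.CertifiedManyBodySolver.Observables.TorusPairLROCeiling
open scoped ComplexOrder

/-! ### §1 The ceiling, uniformly in the ground state -/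

section Uniform

/-- **Step (ε) with `ω`-INDEPENDENT constants** (re-quantification of `boxTorusBound`): for every `h₀` there are
`c₁ = 4C_src`, `c₂ = 16K_d²`, `L₁` such that for EVERY translation-invariant ground state `ω` of `Ψ_{h₀}`, every
`L ≥ L₁` and `g ≥ 0`, `E₀(A_L(h₀) − (g/L²)Δ_dᴴΔ_d) ≤ L²·E(h₀) + c₁L − g·L²·boxLRO_L(ω) + g·c₂L`.
[cite: BruPedra2013, Thm 107] -/
theorem boxTorusBound_uniform (tp U μ h₀ : ℝ) :
    ∃ c₁ c₂ : ℝ, ∃ L₁ : ℕ, ∀ ⦃ω : InfVolFermionState 2⦄,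
      ω.IsMeanEnergyMinimiser (hubbardTTPrimeSourcedInteraction 1 tp U μ dWaveFormFactor h₀) 1 →
      ∀ (L : ℕ) [NeZero L], L₁ ≤ L → ∀ g : ℝ, 0 ≤ g →
        (dWaveSourceTorusTT' L tp U μ h₀ - ((g / (L : ℝ) ^ 2 : ℝ) : ℂ) •
            ((pairField dWaveFormFactor L)ᴴ * pairField dWaveFormFactor L)).groundEnergy ≤
          (L : ℝ) ^ 2 * dWaveSourceEnergyDensityTT' tp U μ h₀ + c₁ * L -
            g * (L : ℝ) ^ 2 * (((L : ℂ) ^ 4)⁻¹ * ∑ x ∈ halfOpenBox 2 L, ∑ y ∈ halfOpenBox 2 L,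
              ω.dWavePairCorr x y).re + g * c₂ * L := by
  obtain ⟨Li, hLi⟩ := exists_forall_le_injOn_proj (d := 2) dWaveSourceWindow
  refine ⟨4 * (-(-dWaveSourceEnergyObsTT' tp U μ h₀).groundEnergy -
      (dWaveSourceEnergyObsTT' tp U μ h₀).groundEnergy),
    16 * (2 * ∑ e ∈ insert (0 : Site 2) unitSteps, |dWaveFormFactor e / Real.sqrt 2|) ^ 2,
    max 3 Li, fun ω hω L _ hL g hg => ?_⟩
  have h3 : 3 ≤ L := le_trans (le_max_left _ _) hL
  have hInj := hLi L (le_trans (le_max_right _ _) hL)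
  have hL0 : (0 : ℝ) < (L : ℝ) := by exact_mod_cast (show 0 < L by omega)
  have key := hω.groundEnergy_dWaveSourceTorusTT'_sub_smul_le (L := L) h3 hInj (c := g / (L : ℝ) ^ 2)
    (by positivity)
  have e : (L : ℝ) ^ 2 * dWaveSourceEnergyDensityTT' tp U μ h₀ +
        4 * L * (-(-dWaveSourceEnergyObsTT' tp U μ h₀).groundEnergy -
          (dWaveSourceEnergyObsTT' tp U μ h₀).groundEnergy) -
        g / (L : ℝ) ^ 2 * ((L : ℝ) ^ 4 * (((L : ℂ) ^ 4)⁻¹ * ∑ x ∈ halfOpenBox 2 L,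
          ∑ y ∈ halfOpenBox 2 L, ω.dWavePairCorr x y).re -
          16 * (2 * ∑ e ∈ insert (0 : Site 2) unitSteps, |dWaveFormFactor e / Real.sqrt 2|) ^ 2 *
            (L : ℝ) ^ 3) =
      (L : ℝ) ^ 2 * dWaveSourceEnergyDensityTT' tp U μ h₀ +
          4 * (-(-dWaveSourceEnergyObsTT' tp U μ h₀).groundEnergy -
            (dWaveSourceEnergyObsTT' tp U μ h₀).groundEnergy) * L -
        g * (L : ℝ) ^ 2 * (((L : ℂ) ^ 4)⁻¹ * ∑ x ∈ halfOpenBox 2 L, ∑ y ∈ halfOpenBox 2 L,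
          ω.dWavePairCorr x y).re +
        g * (16 * (2 * ∑ e ∈ insert (0 : Site 2) unitSteps, |dWaveFormFactor e / Real.sqrt 2|) ^ 2) * L := by
    field_simp
    ring
  rw [e] at key
  exact key

/-- **THE PAIR-LRO CEILING, UNIFORMLY IN THE GROUND STATE**: for `h₀ ≥ 0` and `ε > 0` there is `N₀` such that EVERY
translation-invariant ground state `ω` of `Ψ_{h₀} = hubbardTTPrimeSourcedInteraction 1 t' U μ dWaveFormFactor h₀` has
`boxLRO_N(ω) ≤ (∂⁺E(h₀)/2)² + ε` for all `N ≥ N₀` — p3's (ζ)(η) assembly (`tiGroundStatePairLROCeiling_of_boxTorusBound`)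
re-run with the `ω`-independent constants of `boxTorusBound_uniform`. [cite: KomaTasaki1993, Theorem 7.3]
[cite: BruPedra2013, Thm 107] [cite: Griffiths1966, §II] -/
theorem tiGroundStatePairLROCeiling_uniform (tp U μ : ℝ) {h₀ : ℝ} (hh₀ : 0 ≤ h₀) {ε : ℝ} (hε : 0 < ε) :
    ∃ N₀ : ℕ, ∀ ⦃ω : InfVolFermionState 2⦄,
      ω.IsMeanEnergyMinimiser (hubbardTTPrimeSourcedInteraction 1 tp U μ dWaveFormFactor h₀) 1 →
      ∀ N : ℕ, N₀ ≤ N →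
        (((N : ℂ) ^ 4)⁻¹ * ∑ x ∈ halfOpenBox 2 N, ∑ y ∈ halfOpenBox 2 N, ω.dWavePairCorr x y).re ≤
          (derivWithin (dWaveSourceEnergyDensityTT' tp U μ) (Ioi h₀) h₀ / 2) ^ 2 + ε := by
  have hK0 : (0 : ℝ) ≤ 2 * ∑ e ∈ insert (0 : Site 2) unitSteps, |dWaveFormFactor e / Real.sqrt 2| := by
    positivity
  -- (η): right-continuity of `(∂⁺E/2)²` at `h₀`, then a coupling `g > 0` with `2g‖P‖ < u`
  obtain ⟨u, hu0, hu⟩ := exists_sq_half_rightDeriv_le_add tp U μ h₀ (ε := ε / 4) (by positivity)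
  obtain ⟨g, hgdef⟩ : ∃ g : ℝ,
      g = u / (2 * (2 * (2 * ∑ e ∈ insert (0 : Site 2) unitSteps, |dWaveFormFactor e / Real.sqrt 2|) + 1)) :=
    ⟨_, rfl⟩
  have hg : 0 < g := by rw [hgdef]; positivity
  have h2gK : 2 * g * (2 * ∑ e ∈ insert (0 : Site 2) unitSteps, |dWaveFormFactor e / Real.sqrt 2|) < u := by
    set K : ℝ := 2 * ∑ e ∈ insert (0 : Site 2) unitSteps, |dWaveFormFactor e / Real.sqrt 2| with hK
    rw [hgdef]
    have e1 : 2 * (u / (2 * (2 * K + 1))) * K = u * (K / (2 * K + 1)) := by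
      field_simp
    rw [e1]
    have h1 : K / (2 * K + 1) < 1 := (div_lt_one (by positivity)).2 (by linarith)
    calc u * (K / (2 * K + 1)) < u * 1 := mul_lt_mul_of_pos_left h1 hu0
      _ = u := mul_one _
  have h2gK0 : 0 ≤ 2 * g * (2 * ∑ e ∈ insert (0 : Site 2) unitSteps, |dWaveFormFactor e / Real.sqrt 2|) := by
    positivity
  have hx0 : 0 ≤ h₀ + 2 * g * (2 * ∑ e ∈ insert (0 : Site 2) unitSteps, |dWaveFormFactor e / Real.sqrt 2|) := by
    linarith
  have ha := hu (h₀ + 2 * g * (2 * ∑ e ∈ insert (0 : Site 2) unitSteps, |dWaveFormFactor e / Real.sqrt 2|))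
    (by linarith) (by linarith)
  -- the finite-volume sandwich at accuracy `gε/8`, and the UNIFORM box→torus bound
  obtain ⟨L₀, hL₀⟩ := (ahmTT'_sandwich tp U g |μ| h₀ hg).2 (g * ε / 8) (by positivity)
  obtain ⟨c₁, c₂, L₁, hL₁⟩ := boxTorusBound_uniform tp U μ h₀
  have hlow : ∀ᶠ n : ℕ in atTop,
      (dWaveSourceTorusTT' (n + 1) tp U μ h₀).groundEnergy / (((n + 1 : ℕ) : ℝ)) ^ 2 -
            g * dWaveSourceDensityTT' (n + 1) tp U μ (h₀ + 2 * g *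
              (2 * ∑ e ∈ insert (0 : Site 2) unitSteps, |dWaveFormFactor e / Real.sqrt 2|)) ^ 2 -
          g * ε / 8 ≤
        (dWaveSourceTorusTT' (n + 1) tp U μ h₀ - ((g / (((n + 1 : ℕ) : ℝ)) ^ 2 : ℝ) : ℂ) •
            ((pairField dWaveFormFactor (n + 1))ᴴ * pairField dWaveFormFactor (n + 1))).groundEnergy /
          (((n + 1 : ℕ) : ℝ)) ^ 2 :=
    eventually_atTop.2 ⟨L₀, fun n hn => hL₀ (n + 1) (by omega) μ le_rfl h₀ hh₀ le_rfl⟩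
  -- `m_L(h₀ + 2g‖P‖)² ≤ (∂⁺E(h₀ + 2g‖P‖)/2)² + ε/4` eventually
  have hdens := eventually_sq_dWaveSourceDensityTT'_le tp U μ hx0 (δ := ε / 4) (by positivity)
  -- `E_L(h₀)/L² → E(h₀)`
  have hconv : ∀ᶠ n : ℕ in atTop, dWaveSourceEnergyDensityTT' tp U μ h₀ -
      (dWaveSourceTorusTT' (n + 1) tp U μ h₀).groundEnergy / (((n + 1 : ℕ) : ℝ)) ^ 2 ≤ g * ε / 8 := by
    have ht := tendsto_dWaveSourceEnergyDensityTT' tp U μ h₀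
    have hev := ht.eventually (Ioi_mem_nhds
      (show dWaveSourceEnergyDensityTT' tp U μ h₀ - g * ε / 8 < dWaveSourceEnergyDensityTT' tp U μ h₀ by
        have : 0 < g * ε / 8 := by positivity
        linarith))
    filter_upwards [hev] with n hn
    have hn' : dWaveSourceEnergyDensityTT' tp U μ h₀ - g * ε / 8 <
        (dWaveSourceTorusTT' (n + 1) tp U μ h₀).groundEnergy / (((n + 1 : ℕ) : ℝ)) ^ 2 := hn
    linarith
  -- `(c₁ + gc₂)/L → 0`
  have hsmall : ∀ᶠ n : ℕ in atTop, (c₁ + g * c₂) * ((n + 1 : ℕ) : ℝ) / (((n + 1 : ℕ) : ℝ)) ^ 2 ≤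
      g * ε / 8 := by
    obtain ⟨N, hN⟩ := exists_nat_gt (|c₁ + g * c₂| / (g * ε / 8))
    refine eventually_atTop.2 ⟨N, fun n hn => ?_⟩
    have hℓ : (0 : ℝ) < ((n + 1 : ℕ) : ℝ) := by positivity
    have hgε : 0 < g * ε / 8 := by positivity
    have hNℓ : (N : ℝ) < ((n + 1 : ℕ) : ℝ) := by exact_mod_cast Nat.lt_succ_of_le hn
    have h1 : |c₁ + g * c₂| < g * ε / 8 * ((n + 1 : ℕ) : ℝ) := by
      rw [div_lt_iff₀ hgε] at hN
      nlinarith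
    rw [pow_two, mul_div_mul_right _ _ hℓ.ne', div_le_iff₀ hℓ]
    exact ((le_abs_self _).trans h1.le)
  -- an `ω`-independent threshold
  obtain ⟨N, hN⟩ := eventually_atTop.1 (hlow.and (hdens.and (hconv.and hsmall)))
  refine ⟨max (N + 1) L₁, fun ω hω M hM => ?_⟩
  obtain ⟨n, rfl⟩ : ∃ n, M = n + 1 := ⟨M - 1, by omega⟩
  obtain ⟨hl, hd, hc, hs⟩ := hN n (by omega)
  have hup := hL₁ hω (n + 1) (le_trans (le_max_right _ _) hM) g hg.le
  have hV : (0 : ℝ) < (((n + 1 : ℕ) : ℝ)) ^ 2 := by positivity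
  exact boxLRO_le_of_bounds hV hg hε hl hup hc hd ha hs

end Uniform

/-! ### §2 Full-sequence window tightness -/

section FullSequence

variable {ψ : ∀ L, Fock (Orb (FermionTorus 2 L))} {Ls : ℕ → ℕ} [∀ j, NeZero (Ls j)]

/-- **ABSTRACT FULL-SEQUENCE PASSAGE** (any form factor `g`): if the torus diagonals converge along the WHOLE sequence,
`s_{L_j} → c`, and at ONE box size `n ≥ 1` every torus limit `ω` of every subsequence has `boxavg_n(ω) ≤ c + τ/16`, then
for every `0 < ε` with `nε ≤ π/6`, eventually `T_ε(ψ_{L_j})/L_j² ≤ τ`. (Otherwise a subsequence has `T_ε > τ`; a further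
subsequence has a torus limit `ω`; along it `b_{L,n} → boxavg_n(ω)` and `s → c`, contradicting the reverse Fejér
inequality `s + T_ε/4 ≤ b_{L,n}`.) [cite: KLS1988PRL, p. 2583] -/
theorem eventually_windowTail_le_of_forall_torusLimit (g : Site 2 → ℝ) (hLs : Tendsto Ls atTop atTop)
    (hunit : ∀ j, star (ψ (Ls j)) ⬝ᵥ ψ (Ls j) = 1) {c : ℝ}
    (hs : Tendsto (fun j => torusDiagonal g (Ls j) (ψ (Ls j))) atTop (𝓝 c)) {n : ℕ} (hn : n ≠ 0)
    {τ : ℝ} (hτ : 0 < τ)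
    (hceil : ∀ φ : ℕ → ℕ, StrictMono φ → ∀ ω : InfVolFermionState 2, ω.IsTorusLimitOf ψ (Ls ∘ φ) →
      (((n : ℂ) ^ 4)⁻¹ * ∑ x ∈ halfOpenBox 2 n, ∑ y ∈ halfOpenBox 2 n,
        ω.pairCorr (insert 0 unitSteps) g x y).re ≤ c + τ / 16)
    {ε : ℝ} (hε : 0 < ε) (hnε : (n : ℝ) * ε ≤ Real.pi / 6) :
    ∀ᶠ j in atTop, windowTail g (Ls j) (ψ (Ls j)) ε ≤ τ := by
  by_contra hnot
  rw [Filter.not_eventually] at hnot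
  obtain ⟨φ₀, hφ₀, hbig⟩ := Filter.extraction_of_frequently_atTop hnot
  have hLs₀ : Tendsto (Ls ∘ φ₀) atTop atTop := hLs.comp hφ₀.tendsto_atTop
  obtain ⟨φ₁, hφ₁, ω, hω⟩ :=
    InfVolFermionState.exists_isTorusLimitOf_subseq ψ hLs₀ (fun j => hunit (φ₀ j))
  have hφ : StrictMono (φ₀ ∘ φ₁) := hφ₀.comp hφ₁
  haveI hNZ : ∀ k, NeZero (((Ls ∘ φ₀) ∘ φ₁) k) := fun k => inferInstanceAs (NeZero (Ls (φ₀ (φ₁ k))))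
  have hLs₁ : Tendsto ((Ls ∘ φ₀) ∘ φ₁) atTop atTop := hLs₀.comp hφ₁.tendsto_atTop
  have hB := hceil (φ₀ ∘ φ₁) hφ ω hω
  have hb := hω.tendsto_boxAvgPairCorr g hLs₁ n
  have h1 : ∀ᶠ k in atTop, boxAvgPairCorr g (((Ls ∘ φ₀) ∘ φ₁) k) (ψ (((Ls ∘ φ₀) ∘ φ₁) k)) n <
      (((n : ℂ) ^ 4)⁻¹ * ∑ x ∈ halfOpenBox 2 n, ∑ y ∈ halfOpenBox 2 n,
        ω.pairCorr (insert 0 unitSteps) g x y).re + τ / 16 :=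
    hb.eventually (Iio_mem_nhds (by linarith))
  have hs' : Tendsto (fun k => torusDiagonal g (Ls (φ₀ (φ₁ k))) (ψ (Ls (φ₀ (φ₁ k))))) atTop (𝓝 c) :=
    hs.comp hφ.tendsto_atTop
  have h2 : ∀ᶠ k in atTop, c - τ / 8 < torusDiagonal g (Ls (φ₀ (φ₁ k))) (ψ (Ls (φ₀ (φ₁ k)))) :=
    hs'.eventually (Ioi_mem_nhds (by linarith))
  obtain ⟨k, hk1, hk2⟩ := (h1.and h2).exists
  have hrev := torusDiagonal_add_windowTail_div_four_le_boxAvgPairCorr (Ls (φ₀ (φ₁ k))) g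
    (ψ (Ls (φ₀ (φ₁ k)))) hn hε.le hnε
  have hcontra := hbig (φ₁ k)
  simp only [Function.comp_apply] at hk1
  exact hcontra (by linarith)

variable {t' U μ h : ℝ}

/-- **`h > 0` OFF THE KINKS: EVERY SEQUENCE OF SOURCED GROUND-STATE VECTORS IS WINDOW TIGHT** (full-sequence form of
`eventually_windowTail_le_of_groundStates_of_hasDerivAt`, no torus-limit hypothesis): for unit ground-state vectors
`ψ_{L_j}` of `dWaveSourceTorusTT' (Ls j) t' U μ h` along any `L_j → ∞`, with `E` differentiable at `h > 0`:
`∀ τ > 0, ∃ ε₀ > 0, ∀ ε ∈ (0,ε₀], ∀ᶠ j, T_ε(ψ_{L_j})/L_j² ≤ τ`. (Uniform ceiling §1 fixes the box size before the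
subsequence is chosen.) [cite: KomaTasaki1993, Theorem 7.3] -/
theorem eventually_windowTail_le_of_groundStates_of_hasDerivAt' (hLs : Tendsto Ls atTop atTop) (hh : 0 < h)
    (hunit : ∀ j, star (ψ (Ls j)) ⬝ᵥ ψ (Ls j) = 1)
    (hgs : ∀ j, dWaveSourceTorusTT' (Ls j) t' U μ h *ᵥ ψ (Ls j) =
      (((dWaveSourceTorusTT' (Ls j) t' U μ h).groundEnergy : ℝ) : ℂ) • ψ (Ls j))
    {e' : ℝ} (hd : HasDerivAt (dWaveSourceEnergyDensityTT' t' U μ) e' h) {τ : ℝ} (hτ : 0 < τ) :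
    ∃ ε₀ : ℝ, 0 < ε₀ ∧ ∀ ε : ℝ, 0 < ε → ε ≤ ε₀ →
      ∀ᶠ j in atTop, windowTail dWaveFormFactor (Ls j) (ψ (Ls j)) ε ≤ τ := by
  have hR : derivWithin (dWaveSourceEnergyDensityTT' t' U μ) (Ioi h) h = e' :=
    hd.hasDerivWithinAt.derivWithin (uniqueDiffWithinAt_Ioi h)
  obtain ⟨N₀, hN₀⟩ := tiGroundStatePairLROCeiling_uniform t' U μ hh.le (ε := τ / 16) (by positivity)
  set n : ℕ := max N₀ 1 with hn
  have hn0 : n ≠ 0 := by omega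
  have hnpos : (0 : ℝ) < (n : ℝ) := by exact_mod_cast (show 0 < n by omega)
  refine ⟨Real.pi / 6 / (n : ℝ), by positivity, fun ε hε hεle => ?_⟩
  have hnε : (n : ℝ) * ε ≤ Real.pi / 6 := by
    rw [le_div_iff₀ hnpos] at hεle
    linarith
  refine eventually_windowTail_le_of_forall_torusLimit dWaveFormFactor hLs hunit
    (tendsto_torusDiagonal_of_groundStates_of_hasDerivAt hLs hh hunit hgs hd) hn0 hτ (fun φ hφ ω hω => ?_) hε hnε
  haveI : ∀ k, NeZero ((Ls ∘ φ) k) := fun k => inferInstanceAs (NeZero (Ls (φ k)))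
  have hLs' : Tendsto (Ls ∘ φ) atTop atTop := hLs.comp hφ.tendsto_atTop
  have hmin := hω.isMeanEnergyMinimiser_sourced hLs' (fun j => hunit (φ j)) t' U μ h (fun j => hgs (φ j))
  have hc := hN₀ hmin n (le_max_left _ _)
  rw [hR] at hc
  exact hc

/-- **`h = 0`, `s_{L_j} → (m⋆)²` (whole sequence) ⇒ EVERY such ground-state sequence is window tight** (full-sequence
form; the uniform zero-field ceiling on every torus limit). [cite: KomaTasaki1993, Theorem 7.3] -/
theorem eventually_windowTail_le_of_groundStates_zero_of_tendsto_sq' (hLs : Tendsto Ls atTop atTop)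
    (hunit : ∀ j, star (ψ (Ls j)) ⬝ᵥ ψ (Ls j) = 1)
    (hgs : ∀ j, dWaveSourceTorusTT' (Ls j) t' U μ 0 *ᵥ ψ (Ls j) =
      (((dWaveSourceTorusTT' (Ls j) t' U μ 0).groundEnergy : ℝ) : ℂ) • ψ (Ls j))
    (hs : Tendsto (fun j => torusDiagonal dWaveFormFactor (Ls j) (ψ (Ls j))) atTop
      (𝓝 (dWaveOrderParameterTT' t' U μ ^ 2)))
    {τ : ℝ} (hτ : 0 < τ) :
    ∃ ε₀ : ℝ, 0 < ε₀ ∧ ∀ ε : ℝ, 0 < ε → ε ≤ ε₀ →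
      ∀ᶠ j in atTop, windowTail dWaveFormFactor (Ls j) (ψ (Ls j)) ε ≤ τ := by
  have hsq0 : (derivWithin (dWaveSourceEnergyDensityTT' t' U μ) (Ioi 0) 0 / 2) ^ 2 =
      dWaveOrderParameterTT' t' U μ ^ 2 := by
    rw [dWaveOrderParameterTT'_eq_neg_half_rightDeriv]; ring
  obtain ⟨N₀, hN₀⟩ := tiGroundStatePairLROCeiling_uniform t' U μ le_rfl (ε := τ / 16) (by positivity)
  set n : ℕ := max N₀ 1 with hn
  have hn0 : n ≠ 0 := by omega
  have hnpos : (0 : ℝ) < (n : ℝ) := by exact_mod_cast (show 0 < n by omega)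
  refine ⟨Real.pi / 6 / (n : ℝ), by positivity, fun ε hε hεle => ?_⟩
  have hnε : (n : ℝ) * ε ≤ Real.pi / 6 := by
    rw [le_div_iff₀ hnpos] at hεle
    linarith
  refine eventually_windowTail_le_of_forall_torusLimit dWaveFormFactor hLs hunit hs hn0 hτ
    (fun φ hφ ω hω => ?_) hε hnε
  haveI : ∀ k, NeZero ((Ls ∘ φ) k) := fun k => inferInstanceAs (NeZero (Ls (φ k)))
  have hLs' : Tendsto (Ls ∘ φ) atTop atTop := hLs.comp hφ.tendsto_atTop
  have hmin := hω.isMeanEnergyMinimiser_sourced hLs' (fun j => hunit (φ j)) t' U μ 0 (fun j => hgs (φ j))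
  have hc := hN₀ hmin n (le_max_left _ _)
  rw [hsq0] at hc
  exact hc

/-- **`h = 0`, `m⋆ = 0`: EVERY ground-state sequence of the grand-canonical `t–t'` tori is window tight** (full-sequence
form of `…_zero_of_not_hasDWaveOrderTT'`): in the ABSENT world `[BN7]` holds outright.
[cite: KomaTasaki1993, Theorem 7.3] [cite: KomaTasaki1994, §1] -/
theorem eventually_windowTail_le_of_groundStates_zero_of_not_hasDWaveOrderTT'' (hLs : Tendsto Ls atTop atTop)
    (hunit : ∀ j, star (ψ (Ls j)) ⬝ᵥ ψ (Ls j) = 1)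
    (hgs : ∀ j, dWaveSourceTorusTT' (Ls j) t' U μ 0 *ᵥ ψ (Ls j) =
      (((dWaveSourceTorusTT' (Ls j) t' U μ 0).groundEnergy : ℝ) : ℂ) • ψ (Ls j))
    (hno : ¬ HasDWaveOrderTT' t' U μ) {τ : ℝ} (hτ : 0 < τ) :
    ∃ ε₀ : ℝ, 0 < ε₀ ∧ ∀ ε : ℝ, 0 < ε → ε ≤ ε₀ →
      ∀ᶠ j in atTop, windowTail dWaveFormFactor (Ls j) (ψ (Ls j)) ε ≤ τ := by
  have h0 : dWaveOrderParameterTT' t' U μ = 0 :=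
    le_antisymm (not_lt.1 hno) (dWaveOrderParameterTT'_nonneg t' U μ)
  refine eventually_windowTail_le_of_groundStates_zero_of_tendsto_sq' hLs hunit hgs ?_ hτ
  rw [h0, tendsto_order]
  refine ⟨fun a ha => Eventually.of_forall fun j => ?_, fun b hb => ?_⟩
  · have := torusDiagonal_nonneg dWaveFormFactor (Ls j) (ψ (Ls j))
    have ha' : a < 0 := by simpa using ha
    linarith
  · have hb' : 0 < b := by simpa using hb
    filter_upwards [eventually_torusDiagonal_le_sq_dWaveOrderParameterTT'_add hLs hunit hgs (half_pos hb')] with j hj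
    rw [h0] at hj
    linarith

/-- **UNDER `[U]`, FULL-SEQUENCE EQUIVALENCE: window tightness ⇔ `s_{L_j} → (m⋆)²`** for any fixed-`N` sequence of unit
ground-state vectors of the grand-canonical `t–t'` tori at `h = 0` along `L_j → ∞` (no torus-limit hypothesis). `⇒`:
every subsequence has, by hubbard-cq-p4's `exists_subseq_tendsto_torusDiagonal_sq_dWaveOrderParameterTT'_of_unique_
symmetric_of_tight`, a sub-subsequence along which `s → (m⋆)²`, hence the whole sequence converges
(`tendsto_of_subseq_tendsto`); `⇐`: the previous theorem. [cite: KomaTasaki1994, §1] [cite: KomaTasaki1993, Theorem 7.3] -/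
theorem windowTight_iff_tendsto_sq_of_unique_symmetric'
    (hU : ∀ ω₁ ω₂ : InfVolFermionState 2,
      ω₁.IsMeanEnergyMinimiser (hubbardTTPrimeMuInteraction 1 t' U μ) 1 → ω₁.IsGaugeInvariant →
      ω₂.IsMeanEnergyMinimiser (hubbardTTPrimeMuInteraction 1 t' U μ) 1 → ω₂.IsGaugeInvariant → ω₁ = ω₂)
    (hLs : Tendsto Ls atTop atTop)
    (hunit : ∀ j, star (ψ (Ls j)) ⬝ᵥ ψ (Ls j) = 1) {N : ℕ → ℕ} (hN : ∀ j, IsNParticle (N j) (ψ (Ls j)))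
    (hgs : ∀ j, dWaveSourceTorusTT' (Ls j) t' U μ 0 *ᵥ ψ (Ls j) =
      (((dWaveSourceTorusTT' (Ls j) t' U μ 0).groundEnergy : ℝ) : ℂ) • ψ (Ls j)) :
    (∀ τ : ℝ, 0 < τ → ∃ ε₀ : ℝ, 0 < ε₀ ∧ ∀ ε : ℝ, 0 < ε → ε ≤ ε₀ →
        ∀ᶠ j in atTop, windowTail dWaveFormFactor (Ls j) (ψ (Ls j)) ε ≤ τ) ↔
      Tendsto (fun j => torusDiagonal dWaveFormFactor (Ls j) (ψ (Ls j))) atTop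
        (𝓝 (dWaveOrderParameterTT' t' U μ ^ 2)) := by
  constructor
  · intro H
    obtain ⟨τ, hτ, hτ0⟩ := exists_tightFunction_of_forall_eventually_windowTail_le dWaveFormFactor hunit H
    refine tendsto_of_subseq_tendsto fun ns hns => ?_
    haveI : ∀ k, NeZero ((Ls ∘ ns) k) := fun k => inferInstanceAs (NeZero (Ls (ns k)))
    have hLs' : Tendsto (Ls ∘ ns) atTop atTop := hLs.comp hns
    obtain ⟨φ, -, hφ⟩ :=
      exists_subseq_tendsto_torusDiagonal_sq_dWaveOrderParameterTT'_of_unique_symmetric_of_tight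
        (ψ := ψ) (Ls := Ls ∘ ns) hU hLs' (fun j => hunit (ns j)) (fun j => hN (ns j)) (fun j => hgs (ns j))
        (fun ε hε => hns.eventually (hτ ε hε)) hτ0
    exact ⟨φ, hφ⟩
  · intro hs τ hτ
    exact eventually_windowTail_le_of_groundStates_zero_of_tendsto_sq' hLs hunit hgs hs hτ

end FullSequence

end Summit.Ventures.CertifiedManyBodySolver.Observables.TorusWindowTightness

end
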